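import Summits.AtomisticToContinuum.FouriersLaw.Theorems.BondHeatUncertaintySubdiffusiveBondHeatLocalEnergyMoment
import Summits.AtomisticToContinuum.FouriersLaw.Theorems.BondHeatUncertaintySubdiffusiveBondHeatSiteEnergyCurrentCovariance
import Summits.AtomisticToContinuum.FouriersLaw.Theorems.BondHeatUncertaintyLightConeBondHeatBondCorrelation

/-!
# The `N`-uniform second moment of the contact current under the Gibbs state

Helper (`--supports`) for the line `contact-current-forgetting` of the crux `JunctionLocality.NonBallistic`
(stmt-AtomisticToContinuum-9127), stub `stub_lightConeWindow` (LC): the STATIC input (S) of the reduction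
`lightConeWindow_of_flipInsensitivity` (`…StubLightConeWindowAux3`),

  `∃ C, ∀ N, ∫ j₀² dμ_T^N ≤ C`,   `j₀ = -½ (p₀ + p₁) V'(q₁ - q₀)`,  `V'(r) = r + β r³`,

for the pinned anharmonic chain. Proof: `j₀² ≤ ½ (p₀² + p₁²) W(q)`, `W = V'(q₁ - q₀)²`; Gaussian integration by
parts in `p₀` and in `p₁` against the position observable `W` (`∫ W pᵢ² e^{-H/T} = T ∫ W e^{-H/T}`,
`pinnedChain_integral_posObs_sq_momentum_mul_gibbsDensity_of_le_sq`, the `(1+H)²`-dominated variant of the tree's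
`(1+H)`-dominated lemma), so `∫ j₀² dμ_T ≤ T ∫ W dμ_T`; and `W ≤ (1+β)² (1 + (q₁-q₀)⁸) ≤ (1+β)²(1 + 128 q₀⁸ + 128 q₁⁸)`
with the landed `N`-UNIFORM eighth moments `stub_gibbsPositionEighthMoment`.
-/

noncomputable section

open MeasureTheory

namespace Summit.AtomisticToContinuum.FouriersLaw.Theorems.NonBallistic

open Literature.MathematicalPhysics.KineticTheory.HeatConduction
open Summit.AtomisticToContinuum.FouriersLaw.Theorems.SubdiffusiveBondHeat
open Summit.AtomisticToContinuum.FouriersLaw.Theorems.LightConeBondHeat (pinnedChain_integrable_sq_bondCurrent)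

variable {N : ℕ} {ω₂ lam β : ℝ}

/-- **Gaussian integration by parts in one momentum against a position observable**, `(1+H)²`-dominated
variant: for a continuous `G = G(q)` with `|G| ≤ C (1 + H)²`, `G e^{-H/T}` and `G pᵢ² e^{-H/T}` are integrable and
`∫ G pᵢ² e^{-H/T} = T ∫ G e^{-H/T}`. [folklore] -/
theorem pinnedChain_integral_posObs_sq_momentum_mul_gibbsDensity_of_le_sq (hω : 0 < ω₂) (hl : 0 ≤ lam)
    (hβ : 0 ≤ β) (γ : ℝ) (N : ℕ) {T : ℝ} (hT : 0 < T) (i : Fin N) {G : (Fin N → ℝ) → ℝ}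
    (hG : Continuous G) {C : ℝ} (hC : 0 ≤ C)
    (hle : ∀ x : PhaseSpace N, |G x.1| ≤ C * (1 + (pinnedChain ω₂ lam β γ).hamiltonian N x) ^ 2) :
    (Integrable fun x => G x.1 * (pinnedChain ω₂ lam β γ).gibbsDensity N T x) ∧
    (Integrable fun x => G x.1 * x.2 i ^ 2 * (pinnedChain ω₂ lam β γ).gibbsDensity N T x) ∧
    ∫ x, G x.1 * x.2 i ^ 2 * (pinnedChain ω₂ lam β γ).gibbsDensity N T x =
      T * ∫ x, G x.1 * (pinnedChain ω₂ lam β γ).gibbsDensity N T x := by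
  -- adapted from `pinnedChain_integral_posObs_sq_momentum_mul_gibbsDensity` (SiteEnergyCurrentCovariance)
  have hH0 : ∀ x : PhaseSpace N, 0 ≤ (pinnedChain ω₂ lam β γ).hamiltonian N x := fun x =>
    pinnedChain_hamiltonian_nonneg hω.le hl hβ γ N x
  have hp2 : ∀ x : PhaseSpace N, x.2 i ^ 2 ≤ 2 * (pinnedChain ω₂ lam β γ).hamiltonian N x :=
    fun x => pinnedChain_sq_momentum_le hω.le hl hβ γ N x i
  have hGc : Continuous fun x : PhaseSpace N => G x.1 := hG.comp continuous_fst
  have iG : Integrable fun x => G x.1 * (pinnedChain ω₂ lam β γ).gibbsDensity N T x :=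
    pinnedChain_integrable_mul_gibbsDensity_of_le hω hl hβ γ N hT hGc (C := C) hle
  have iGp2 : Integrable fun x => G x.1 * x.2 i ^ 2 * (pinnedChain ω₂ lam β γ).gibbsDensity N T x :=
    pinnedChain_integrable_mul_gibbsDensity_of_le_pow_four hω hl hβ γ N hT (hGc.mul (by fun_prop)) (C := 2 * C)
      fun x => by
        set H := (pinnedChain ω₂ lam β γ).hamiltonian N x
        rw [abs_mul, abs_of_nonneg (sq_nonneg (x.2 i))]
        calc |G x.1| * x.2 i ^ 2 ≤ C * (1 + H) ^ 2 * (2 * H) :=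
              mul_le_mul (hle x) (hp2 x) (sq_nonneg _) (by have := hH0 x; positivity)
          _ ≤ 2 * C * (1 + H) ^ 4 := by
              have h1 : H ≤ (1 + H) ^ 2 := by nlinarith [hH0 x]
              have h2 : 0 ≤ C * (1 + H) ^ 2 := by have := hH0 x; positivity
              nlinarith [mul_le_mul_of_nonneg_left h1 h2]
  have iGp : Integrable fun x => G x.1 * x.2 i * (pinnedChain ω₂ lam β γ).gibbsDensity N T x :=
    pinnedChain_integrable_mul_gibbsDensity_of_le_pow_four hω hl hβ γ N hT (hGc.mul (by fun_prop)) (C := C)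
      fun x => by
        set H := (pinnedChain ω₂ lam β γ).hamiltonian N x
        rw [abs_mul]
        have hp1 : |x.2 i| ≤ 1 + H := by
          have hsq : |x.2 i| ≤ (1 + x.2 i ^ 2) / 2 := by
            nlinarith [sq_nonneg (|x.2 i| - 1), sq_abs (x.2 i), abs_nonneg (x.2 i)]
          linarith [hp2 x]
        calc |G x.1| * |x.2 i| ≤ C * (1 + H) ^ 2 * (1 + H) :=
              mul_le_mul (hle x) hp1 (abs_nonneg _) (by have := hH0 x; positivity)
          _ ≤ C * (1 + H) ^ 4 := by
              have h1 : (1 + H) ^ 3 ≤ (1 + H) ^ 4 :=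
                pow_le_pow_right₀ (by linarith [hH0 x]) (by norm_num)
              nlinarith [mul_le_mul_of_nonneg_left h1 hC]
  have e := integral_mul_eq_neg_of_hasLineDerivAt_of_integrable
    (F := fun x : PhaseSpace N => G x.1 * x.2 i) (F' := fun x : PhaseSpace N => G x.1)
    (g := (pinnedChain ω₂ lam β γ).gibbsDensity N T)
    (g' := fun x => -(x.2 i / T) * (pinnedChain ω₂ lam β γ).gibbsDensity N T x)
    (v := ((0, Pi.single i 1) : PhaseSpace N)) iG ?_ iGp (fun x => ?_)
    (fun x => (pinnedChain ω₂ lam β γ).hasLineDerivAt_gibbsDensity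
      ((pinnedChain ω₂ lam β γ).hasLineDerivAt_hamiltonian_unitP N x i))
  · have lhs : ∫ x, G x.1 * x.2 i *
        (-(x.2 i / T) * (pinnedChain ω₂ lam β γ).gibbsDensity N T x) =
        -T⁻¹ * ∫ x, G x.1 * x.2 i ^ 2 * (pinnedChain ω₂ lam β γ).gibbsDensity N T x := by
      rw [← integral_const_mul]
      refine integral_congr_ae (Filter.Eventually.of_forall fun x => ?_)
      ring
    rw [lhs] at e
    refine ⟨iG, iGp2, ?_⟩
    have hTne : T ≠ 0 := hT.ne'
    calc ∫ x, G x.1 * x.2 i ^ 2 * (pinnedChain ω₂ lam β γ).gibbsDensity N T x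
        = T * (T⁻¹ * ∫ x, G x.1 * x.2 i ^ 2 * (pinnedChain ω₂ lam β γ).gibbsDensity N T x) := by
          rw [← mul_assoc, mul_inv_cancel₀ hTne, one_mul]
      _ = T * ∫ x, G x.1 * (pinnedChain ω₂ lam β γ).gibbsDensity N T x := by
          congr 1
          linarith
  · refine (iGp2.const_mul (-T⁻¹)).congr (Filter.Eventually.of_forall fun x => ?_)
    ring
  · unfold HasLineDerivAt
    have h : (fun t : ℝ => (fun z : PhaseSpace N => G z.1 * z.2 i)
        (x + t • ((0, Pi.single i 1) : PhaseSpace N))) = fun t => G x.1 * (x.2 i + t) := by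
      funext t
      simp
    rw [h]
    have h1 : HasDerivAt (fun t : ℝ => x.2 i + t) 1 0 := (hasDerivAt_id' (0 : ℝ)).const_add _
    refine (h1.const_mul (G x.1)).congr_deriv ?_
    ring

/-- `t ≤ 1 + t⁴` and `t³ ≤ 1 + t⁴` for `t ≥ 0` (AM–GM), in the form `r² ≤ 1 + r⁸`, `r⁶ ≤ 1 + r⁸`. [folklore] -/
theorem sq_le_one_add_pow_eight (r : ℝ) : r ^ 2 ≤ 1 + r ^ 8 ∧ r ^ 6 ≤ 1 + r ^ 8 := by
  have ht : 0 ≤ r ^ 2 := sq_nonneg r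
  set t := r ^ 2 with htdef
  have h8 : r ^ 8 = t ^ 4 := by rw [htdef]; ring
  have h6 : r ^ 6 = t ^ 3 := by rw [htdef]; ring
  rw [h8, h6]
  constructor
  · nlinarith [mul_nonneg (sq_nonneg (t - 1)) (by positivity : (0 : ℝ) ≤ t ^ 2 + 2 * t + 3)]
  · nlinarith [mul_nonneg (sq_nonneg (t - 1)) (by positivity : (0 : ℝ) ≤ 3 * t ^ 2 + 2 * t + 1)]

/-- The squared contact force is controlled by eighth moments: `(r + βr³)² ≤ (1+β)²(1 + r⁸)` (`β ≥ 0`). [folklore] -/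
theorem sq_deriv_V_le (hβ : 0 ≤ β) (r : ℝ) : (r + β * r ^ 3) ^ 2 ≤ (1 + β) ^ 2 * (1 + r ^ 8) := by
  obtain ⟨h2, h6⟩ := sq_le_one_add_pow_eight r
  have h4 := pow_four_le_one_add_pow_eight r
  have e : (r + β * r ^ 3) ^ 2 = r ^ 2 + 2 * β * r ^ 4 + β ^ 2 * r ^ 6 := by ring
  rw [e]
  have hb2 : 0 ≤ β ^ 2 := sq_nonneg β
  nlinarith [mul_le_mul_of_nonneg_left h4 (by positivity : 0 ≤ 2 * β), mul_le_mul_of_nonneg_left h6 hb2]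

/-- **(S) The `N`-uniform second moment of the contact current.** For the pinned anharmonic chain at temperature
`T > 0` there is `C` with `∫ j₀² dμ_T^N ≤ C` for every `N` (and the site `i = 0` carrying the contact bond).
[folklore] -/
theorem pinnedChain_integral_sq_bondCurrent_zero_le :
    ∀ ω₂ lam β γ : ℝ, 0 < ω₂ → 0 < lam → 0 < β → 0 < γ → ∀ T : ℝ, 0 < T →
      ∃ C : ℝ, ∀ (N : ℕ) (i : Fin N), (i : ℕ) = 0 →
        ∫ x, (pinnedChain ω₂ lam β γ).bondCurrent N i x ^ 2 ∂((pinnedChain ω₂ lam β γ).gibbsMeasure N T) ≤ C := by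
  intro ω₂ lam β γ hω hl hβ hγ T hT
  obtain ⟨C₈, hC₈⟩ := stub_gibbsPositionEighthMoment ω₂ lam β γ hω hl hβ hγ T hT
  set P := pinnedChain ω₂ lam β γ with hP
  -- `C₈ ≥ 0` (it bounds a nonnegative integral at `N = 2`)
  have hC₈0 : 0 ≤ C₈ := by
    obtain ⟨-, -, h, -⟩ := hC₈ 2 one_lt_two
    exact le_trans (integral_nonneg fun z => by positivity) h
  refine ⟨T * ((1 + β) ^ 2 * (1 + 128 * C₈ + 128 * C₈)), fun N i hi => ?_⟩
  have hTK : 0 ≤ T * ((1 + β) ^ 2 * (1 + 128 * C₈ + 128 * C₈)) := by positivity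
  by_cases hN : 1 < N
  swap
  · -- `N = 1`: no bond `(0,1)`, `j₀ = 0`
    have hj : ∀ x, P.bondCurrent N i x = 0 := by
      intro x
      unfold OscillatorChain.bondCurrent
      refine Finset.sum_eq_zero fun j _ => ?_
      have : (j : ℕ) ≠ (i : ℕ) + 1 := by have := j.isLt; omega
      rw [if_neg this]
    simp only [hj]
    simpa using hTK
  -- `N ≥ 2`
  have hi0 : i = ⟨0, Nat.zero_lt_of_lt hN⟩ := Fin.ext hi
  subst hi0
  set i : Fin N := ⟨0, Nat.zero_lt_of_lt hN⟩ with hidef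
  set i' : Fin N := ⟨1, hN⟩ with hi'def
  have hii' : (i' : ℕ) = (i : ℕ) + 1 := rfl
  have hne : i ≠ i' := fun h => by have := congrArg Fin.val h; simp [hidef, hi'def] at this
  obtain ⟨hq0i, hq1i, hq0, hq1⟩ := hC₈ N hN
  set μ := P.gibbsMeasure N T with hμ
  haveI : IsProbabilityMeasure μ := pinnedChain_isProbabilityMeasure_gibbsMeasure hω hl.le hβ.le γ N hT
  -- the position observable `W(q) = V'(q₁ - q₀)²`
  set G : (Fin N → ℝ) → ℝ := fun q => (q i' - q i + β * (q i' - q i) ^ 3) ^ 2 with hG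
  have hGc : Continuous G := by simp only [hG]; fun_prop
  have hH0 : ∀ x : PhaseSpace N, 0 ≤ P.hamiltonian N x := fun x => pinnedChain_hamiltonian_nonneg hω.le hl.le hβ.le γ N x
  have hGle : ∀ x : PhaseSpace N, |G x.1| ≤ (3 + β) ^ 2 * (1 + P.hamiltonian N x) ^ 2 := by
    intro x
    have hv := abs_deriv_V_le hβ.le (pinnedChain_bond_le_hamiltonian hω.le hl.le hβ.le γ N x hii')
    have h2 := pow_le_pow_left₀ (abs_nonneg _) hv 2
    rw [sq_abs, mul_pow] at h2
    simp only [hG]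
    rw [abs_of_nonneg (sq_nonneg _)]
    exact h2
  -- the closed form of `j₀` and the pointwise bound `j₀² ≤ ½(p₀² + p₁²) W`
  have hj : ∀ x : PhaseSpace N, P.bondCurrent N i x = -((x.2 i + x.2 i') / 2 * (x.1 i' - x.1 i + β * (x.1 i' - x.1 i) ^ 3)) := by
    intro x
    unfold OscillatorChain.bondCurrent
    rw [Finset.sum_eq_single i']
    · rw [if_pos hii', hP, pinnedChain_deriv_V]
    · intro j _ hj
      have : (j : ℕ) ≠ (i : ℕ) + 1 := fun h => hj (Fin.ext (by simp [hi'def]; simpa [hidef] using h))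
      rw [if_neg this]
    · intro h; exact absurd (Finset.mem_univ _) h
  have hpt : ∀ x : PhaseSpace N, P.bondCurrent N i x ^ 2 ≤ (x.2 i ^ 2 + x.2 i' ^ 2) / 2 * G x.1 := by
    intro x
    rw [hj x]
    have hG0 : 0 ≤ G x.1 := sq_nonneg _
    have e : (-((x.2 i + x.2 i') / 2 * (x.1 i' - x.1 i + β * (x.1 i' - x.1 i) ^ 3))) ^ 2 =
        ((x.2 i + x.2 i') / 2) ^ 2 * G x.1 := by rw [hG]; ring
    rw [e]
    refine mul_le_mul_of_nonneg_right ?_ hG0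
    nlinarith [sq_nonneg (x.2 i - x.2 i')]
  -- Gaussian integration by parts in `p₀` and `p₁`
  have hC3 : (0 : ℝ) ≤ (3 + β) ^ 2 := sq_nonneg _
  obtain ⟨iG, iGp0, e0⟩ := pinnedChain_integral_posObs_sq_momentum_mul_gibbsDensity_of_le_sq hω hl.le hβ.le γ N hT i
    hGc hC3 hGle
  obtain ⟨-, iGp1, e1⟩ := pinnedChain_integral_posObs_sq_momentum_mul_gibbsDensity_of_le_sq hω hl.le hβ.le γ N hT i'
    hGc hC3 hGle
  -- integrability under `μ_T` of the majorant and of `G`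
  have hmajL : Integrable fun x : PhaseSpace N => (x.2 i ^ 2 + x.2 i' ^ 2) / 2 * G x.1 * P.gibbsDensity N T x := by
    have := (iGp0.add iGp1).div_const 2
    refine this.congr (Filter.Eventually.of_forall fun x => ?_)
    simp only [Pi.add_apply]
    ring
  have hmaj : Integrable (fun x : PhaseSpace N => (x.2 i ^ 2 + x.2 i' ^ 2) / 2 * G x.1) μ :=
    P.integrable_gibbsMeasure hmajL
  have hGμ : Integrable (fun x : PhaseSpace N => G x.1) μ := P.integrable_gibbsMeasure iG
  -- step 1: `∫ j₀² dμ ≤ ∫ ½(p₀²+p₁²) W dμ`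
  have h1 : ∫ x, P.bondCurrent N i x ^ 2 ∂μ ≤ ∫ x, (x.2 i ^ 2 + x.2 i' ^ 2) / 2 * G x.1 ∂μ :=
    integral_mono (pinnedChain_integrable_sq_bondCurrent hω hl.le hβ hγ (Nat.zero_lt_of_lt hN) hT i) hmaj hpt
  -- step 2: `∫ ½(p₀²+p₁²) W dμ = T ∫ W dμ`
  have h2 : ∫ x, (x.2 i ^ 2 + x.2 i' ^ 2) / 2 * G x.1 ∂μ = T * ∫ x, G x.1 ∂μ := by
    rw [hμ, P.integral_gibbsMeasure, P.integral_gibbsMeasure]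
    have hsplit : ∫ x, (x.2 i ^ 2 + x.2 i' ^ 2) / 2 * G x.1 * P.gibbsDensity N T x =
        ((∫ x, G x.1 * x.2 i ^ 2 * P.gibbsDensity N T x) + ∫ x, G x.1 * x.2 i' ^ 2 * P.gibbsDensity N T x) / 2 := by
      rw [← integral_add iGp0 iGp1, ← integral_div]
      refine integral_congr_ae (Filter.Eventually.of_forall fun x => ?_)
      ring
    rw [hsplit, e0, e1]
    ring
  -- step 3: `∫ W dμ ≤ (1+β)² (1 + 128 ∫q₀⁸ + 128 ∫q₁⁸)`
  have h3 : ∫ x, G x.1 ∂μ ≤ (1 + β) ^ 2 * (1 + 128 * C₈ + 128 * C₈) := by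
    have hbound : ∀ x : PhaseSpace N, G x.1 ≤ (1 + β) ^ 2 * (1 + 128 * x.1 i ^ 8 + 128 * x.1 i' ^ 8) := by
      intro x
      have hW := sq_deriv_V_le hβ.le (x.1 i' - x.1 i)
      have h8 := sub_pow_eight_le (x.1 i) (x.1 i')
      simp only [hG]
      nlinarith [mul_le_mul_of_nonneg_left h8 (sq_nonneg (1 + β))]
    have hrhs : Integrable (fun x : PhaseSpace N => (1 + β) ^ 2 * (1 + 128 * x.1 i ^ 8 + 128 * x.1 i' ^ 8)) μ :=
      (((integrable_const 1).add (hq0i.const_mul 128)).add (hq1i.const_mul 128)).const_mul _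
    calc ∫ x, G x.1 ∂μ ≤ ∫ x, (1 + β) ^ 2 * (1 + 128 * x.1 i ^ 8 + 128 * x.1 i' ^ 8) ∂μ :=
          integral_mono hGμ hrhs hbound
      _ = (1 + β) ^ 2 * (1 + 128 * ∫ x, x.1 i ^ 8 ∂μ + 128 * ∫ x, x.1 i' ^ 8 ∂μ) := by
          have hA : Integrable (fun x : PhaseSpace N => (1 : ℝ) + 128 * x.1 i ^ 8) μ :=
            (integrable_const (1 : ℝ)).add (hq0i.const_mul 128)
          have hB : Integrable (fun x : PhaseSpace N => 128 * x.1 i' ^ 8) μ := hq1i.const_mul 128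
          have hA1 : Integrable (fun x : PhaseSpace N => 128 * x.1 i ^ 8) μ := hq0i.const_mul 128
          rw [integral_const_mul, integral_add hA hB, integral_add (integrable_const (1 : ℝ)) hA1,
            integral_const_mul, integral_const_mul]
          simp
      _ ≤ (1 + β) ^ 2 * (1 + 128 * C₈ + 128 * C₈) := by
          gcongr
  calc ∫ x, P.bondCurrent N i x ^ 2 ∂μ ≤ T * ∫ x, G x.1 ∂μ := h1.trans h2.le
    _ ≤ T * ((1 + β) ^ 2 * (1 + 128 * C₈ + 128 * C₈)) := mul_le_mul_of_nonneg_left h3 hT.le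

end Summit.AtomisticToContinuum.FouriersLaw.Theorems.NonBallistic

end
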